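import Summits.Schanuel.Schanuel.Theorems.RootDecomp1EAnchorToolkit
import Summits.Schanuel.Schanuel.Theorems.RootDecomp1AtomRigidity
import Summits.Schanuel.Schanuel.Theorems.RootDecomp1SharedDegree
import Summits.Schanuel.Schanuel.Theorems.RootDecomp1ArgumentCells
import Literature.Barriers.Schanuel.AlgebraicIndependenceOfLogarithms
import Literature.NumberTheory.Transcendental.PeriodsWave0
import Literature.NumberTheory.Transcendental.LindemannWeierstrassProofs
import Literature.NumberTheory.Transcendental.EclPregeometryProofs

/-!
# RootDecomp1 — MODULAR WITNESSES force the entangled class (lens-1 round 11, part A; `--supports stmt-Schanuel-30352`)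

For a tuple `z` write `t₁ = trdeg ℚ(z)`, `t₂ = trdeg ℚ(e^z)`, `t = trdeg ℚ(z, e^z)`, `ε = t₁ + t₂ − t` (the residual
`EntangledSaturatedEssentialSchanuel` = stmt-Schanuel-30352 carries `ε ≥ 1`, `DisjointSaturatedEssentialSchanuel` = 30353
carries `ε = 0`).  A MODULAR WITNESS of `z` is a transcendental number algebraic over BOTH `ℚ(z)` and `ℚ(e^z)` (modular shared
degree `μ ≥ 1`; relative form of the shared degree `σ` of `RootDecomp1SharedDegree`).  This file: a modular witness forces
`ε ≥ 1`; DARK LINES (`w ∈ span_ℚ z` with `e^w ∈ ℚ(z)^alg ∖ ℚ̄`) and LOG-DARK LINES (`w ∈ ℚ(e^z)^alg ∖ ℚ̄`) are modular witnesses,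
covering fixed points `e^ζ = ζ` and exponential chains `e^{z_i} = z_j`.
-/

set_option linter.dupNamespace false

noncomputable section

namespace Summit.Schanuel.Schanuel.Theorems.RootDecomp1ModularLayer

open Complex IntermediateField
open scoped BigOperators Cardinal
open Summit.Schanuel.Schanuel.Theorems.RootDecomp1EAnchor (isAlgebraic_of_trdeg_sandwich trdeg_adjoin_le_of_isAlgebraic
  trdeg_adjoin_union_le trdeg_adjoin_le_nat exists_nat_eq_of_le_natCast isAlgebraic_of_mem_adjoin isAlgebraic_of_le
  isAlgebraic_of_isAlgebraic_adjoin trdeg_adjoin_sum_le_union one_le_trdeg_adjoin_singleton)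
open Summit.Schanuel.Schanuel.Theorems.RootDecomp1ArgumentCells (le_trdeg_of_algebraicIndependent_mem)
open Summit.Schanuel.Schanuel.Theorems.RootDecomp1AtomRigidity (mem_adjoin_range_of_mem_span_int
  exp_mem_adjoin_exp_of_mem_span_int)
open Summit.Schanuel.Schanuel.Theorems.RootDecomp1SharedDegree (trdeg_union_add_one_le_of_shared
  entangled_of_shared_transcendental lt_of_add_one_le_of_le_nat)
open Literature.NumberTheory.Transcendental (SchanuelRank transcendental_exp transcendental_exp_holds
  exists_nsmul_mem_span_int isAlgebraic_adjoin_over_algebraAdjoin)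
open Literature.NumberTheory.Transcendental.OneMotiveToric (trdeg_mono)
open Literature.Barriers.Schanuel (algebraicIndependent_of_le_trdeg_adjoin trdeg_adjoin_union_eq_of_isAlgebraic)

/-! ## §1  MODULAR WITNESSES — a transcendental algebraic over BOTH `ℚ(z)` and `ℚ(e^z)` forces entanglement

Vocabulary for a tuple `z` (fields `ℚ(z)`, `ℚ(e^z)`, degrees `t₁, t₂`, joint degree `t = trdeg ℚ(z, e^z)`):
`ε = t₁ + t₂ − t` the ENTANGLEMENT GRADE (`Cᵉ` = 30352 is the class `ε ≥ 1`, `D` = 30353 the class `ε = 0`),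
`σ = trdeg (ℚ(z) ∩ ℚ(e^z))` the SHARED DEGREE of round 10, and — new here — the MODULAR SHARED DEGREE
`μ = trdeg (ℚ(z)^alg ∩ ℚ(e^z)^alg)`, used only through the predicate `(∃ s : ℂ, Transcendental ℚ s ∧ IsAlgebraic ↥(adjoin ℚ (Set.range z)) s ∧ IsAlgebraic ↥(adjoin ℚ (Set.range (cexp ∘ z))) s)` = "`μ ≥ 1`".
The ladder is `σ ≤ μ ≤ ε ≤ min(t₁, t₂)`; §1 proves `μ ≥ 1 ⟹ ε ≥ 1` and that EVERY explicit special configuration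
(fixed point, Lambert point, exponential chain, dark line `e^w ∈ ℚ(w)^alg`, log-dark line `w ∈ ℚ(e^z)^alg`) has `μ ≥ 1`. -/

/- (port) `(∃ s : ℂ, Transcendental ℚ s ∧ IsAlgebraic ↥(adjoin ℚ (Set.range z)) s ∧ IsAlgebraic ↥(adjoin ℚ (Set.range (cexp ∘ z))) s)` of the node is spelled out as the explicit existential
   `∃ s, Transcendental ℚ s ∧ IsAlgebraic ℚ(z) s ∧ IsAlgebraic ℚ(e^z) s` in every statement below. -/

/-- Adjoining an element algebraic over `ℚ(S)` does not change `trdeg`. [folklore] -/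
theorem trdeg_adjoin_insert_eq_of_isAlgebraic {S : Set ℂ} {s : ℂ} (hs : IsAlgebraic ↥(adjoin ℚ S) s) :
    Algebra.trdeg ℚ ↥(adjoin ℚ (insert s S)) = Algebra.trdeg ℚ ↥(adjoin ℚ S) := by
  refine le_antisymm (trdeg_adjoin_le_of_isAlgebraic ?_) (trdeg_mono (adjoin.mono ℚ _ _ (Set.subset_insert s S)))
  rintro x (rfl | hx)
  · exact hs
  · exact isAlgebraic_of_mem_adjoin (subset_adjoin ℚ S hx)

/-- **STRICT SUBADDITIVITY FROM A MODULAR WITNESS** (relative form of round 10's `trdeg_union_add_one_le_of_shared`):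
if a transcendental `s` is algebraic over `ℚ(S)` and over `ℚ(T)` then `trdeg ℚ(S ∪ T) + 1 ≤ trdeg ℚ(S) + trdeg ℚ(T)`.
Proof: apply the literal lemma to `S' = S ∪ {s}`, `T' = T ∪ {s}` and remove `s` again on all three sides. [this node] -/
theorem trdeg_union_add_one_le_of_isAlgebraic_shared {S T : Set ℂ} {s : ℂ}
    (hsS : IsAlgebraic ↥(adjoin ℚ S) s) (hsT : IsAlgebraic ↥(adjoin ℚ T) s) (hs : Transcendental ℚ s) :
    Algebra.trdeg ℚ ↥(adjoin ℚ (S ∪ T)) + 1 ≤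
      Algebra.trdeg ℚ ↥(adjoin ℚ S) + Algebra.trdeg ℚ ↥(adjoin ℚ T) := by
  have h := trdeg_union_add_one_le_of_shared (S := insert s S) (T := insert s T) (s := s)
    (subset_adjoin ℚ _ (Set.mem_insert s S)) (subset_adjoin ℚ _ (Set.mem_insert s T)) hs
  rw [trdeg_adjoin_insert_eq_of_isAlgebraic hsS, trdeg_adjoin_insert_eq_of_isAlgebraic hsT] at h
  refine le_trans (add_le_add (trdeg_mono (adjoin.mono ℚ _ _ ?_)) le_rfl) h
  exact Set.union_subset_union (Set.subset_insert s S) (Set.subset_insert s T)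

/-- **MODULAR WITNESS ⟹ ENTANGLED** (`μ ≥ 1 ⟹ ε ≥ 1`): the ENTANGLED hypothesis of `Cᵉ` (30352) and the negation of
`D`'s (30353) disjointness follow from one transcendental algebraic over both `ℚ(z)` and `ℚ(e^z)`. -/
theorem entangled_of_isAlgebraic_shared {n : ℕ} (z : Fin n → ℂ) {s : ℂ}
    (hs₁ : IsAlgebraic ↥(adjoin ℚ (Set.range z)) s) (hs₂ : IsAlgebraic ↥(adjoin ℚ (Set.range (cexp ∘ z))) s)
    (hs : Transcendental ℚ s) :
    Algebra.trdeg ℚ ↥(adjoin ℚ (Set.range z ∪ Set.range (cexp ∘ z))) <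
      Algebra.trdeg ℚ ↥(adjoin ℚ (Set.range z)) + Algebra.trdeg ℚ ↥(adjoin ℚ (Set.range (cexp ∘ z))) := by
  have h := trdeg_union_add_one_le_of_isAlgebraic_shared hs₁ hs₂ hs
  refine lt_of_add_one_le_of_le_nat (n := n + n) ?_ h
  refine (trdeg_adjoin_le_nat _ ?_)
  refine (Cardinal.mk_union_le _ _).trans ?_
  have h1 : #(Set.range z) ≤ (n : Cardinal) := by simpa using Cardinal.mk_range_le (f := z)
  have h2 : #(Set.range (cexp ∘ z)) ≤ (n : Cardinal) := by simpa using Cardinal.mk_range_le (f := cexp ∘ z)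
  exact_mod_cast add_le_add h1 h2

/-- **μ ≥ 1 ⟹ ε ≥ 1**: a modular witness forces the entangled class `trdeg ℚ(z, e^z) < trdeg ℚ(z) + trdeg ℚ(e^z)`. -/
theorem entangled_of_modularWitness {n : ℕ} (z : Fin n → ℂ) (h : (∃ s : ℂ, Transcendental ℚ s ∧ IsAlgebraic ↥(adjoin ℚ (Set.range z)) s ∧ IsAlgebraic ↥(adjoin ℚ (Set.range (cexp ∘ z))) s)) :
    Algebra.trdeg ℚ ↥(adjoin ℚ (Set.range z ∪ Set.range (cexp ∘ z))) <
      Algebra.trdeg ℚ ↥(adjoin ℚ (Set.range z)) + Algebra.trdeg ℚ ↥(adjoin ℚ (Set.range (cexp ∘ z))) := by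
  obtain ⟨s, hs, hs₁, hs₂⟩ := h
  exact entangled_of_isAlgebraic_shared z hs₁ hs₂ hs

/-- … hence a tuple with a modular witness never satisfies `D`'s hypothesis `t₁ + t₂ ≤ t`. -/
theorem not_disjoint_of_modularWitness {n : ℕ} (z : Fin n → ℂ) (h : (∃ s : ℂ, Transcendental ℚ s ∧ IsAlgebraic ↥(adjoin ℚ (Set.range z)) s ∧ IsAlgebraic ↥(adjoin ℚ (Set.range (cexp ∘ z))) s)) :
    ¬ (Algebra.trdeg ℚ ↥(adjoin ℚ (Set.range z)) + Algebra.trdeg ℚ ↥(adjoin ℚ (Set.range (cexp ∘ z))) ≤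
        Algebra.trdeg ℚ ↥(adjoin ℚ (Set.range z ∪ Set.range (cexp ∘ z)))) :=
  not_le.mpr (entangled_of_modularWitness z h)

/-- `σ ≥ 1 ⟹ μ ≥ 1`: a literally shared transcendental (round 10) is a modular witness. -/
theorem modularWitness_of_shared {n : ℕ} (z : Fin n → ℂ) {s : ℂ} (hs₁ : s ∈ adjoin ℚ (Set.range z))
    (hs₂ : s ∈ adjoin ℚ (Set.range (cexp ∘ z))) (hs : Transcendental ℚ s) : (∃ s : ℂ, Transcendental ℚ s ∧ IsAlgebraic ↥(adjoin ℚ (Set.range z)) s ∧ IsAlgebraic ↥(adjoin ℚ (Set.range (cexp ∘ z))) s) :=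
  ⟨s, hs, isAlgebraic_of_mem_adjoin hs₁, isAlgebraic_of_mem_adjoin hs₂⟩

/-- The ℚ-span of `z` lies in `ℚ(z)`. -/
theorem mem_adjoin_of_mem_span {n : ℕ} (z : Fin n → ℂ) {w : ℂ} (hw : w ∈ Submodule.span ℚ (Set.range z)) :
    w ∈ adjoin ℚ (Set.range z) := by
  have hle : Submodule.span ℚ (Set.range z) ≤ (adjoin ℚ (Set.range z)).toSubalgebra.toSubmodule := by
    rw [Submodule.span_le]; exact subset_adjoin ℚ _
  exact hle hw

/-- **DARK LINES ENTANGLE.**  If the ℚ-span of `z` contains `w` with `e^w` TRANSCENDENTAL but ALGEBRAIC OVER `ℚ(z)`, then `z`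
has a modular witness (`e^{Nw} = (e^w)^N ∈ ℚ(e^z)` for the denominator `N` of `w`), hence is ENTANGLED.  Covers: fixed points
`e^ζ = ζ`, Lambert points `e^Ω = Ω⁻¹`, chains `e^{z_i} = z_j`, every `w` with `e^w ∈ ℚ(w)^alg ∖ ℚ̄` ("dark line"), and relations
`e^w = P(z)` with `P(z)` transcendental. -/
theorem modularWitness_of_exp_isAlgebraic {n : ℕ} (z : Fin n → ℂ) {w : ℂ} (hw : w ∈ Submodule.span ℚ (Set.range z))
    (halg : IsAlgebraic ↥(adjoin ℚ (Set.range z)) (cexp w)) (ht : Transcendental ℚ (cexp w)) : (∃ s : ℂ, Transcendental ℚ s ∧ IsAlgebraic ↥(adjoin ℚ (Set.range z)) s ∧ IsAlgebraic ↥(adjoin ℚ (Set.range (cexp ∘ z))) s) := by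
  obtain ⟨N, hN, hNw⟩ := exists_nsmul_mem_span_int z hw
  have hpow : cexp ((N : ℚ) • w) = cexp w ^ N := by
    rw [Nat.cast_smul_eq_nsmul, nsmul_eq_mul, Complex.exp_nat_mul]
  refine ⟨cexp w ^ N, ht.pow (Nat.pos_of_ne_zero hN), halg.pow N, isAlgebraic_of_mem_adjoin ?_⟩
  rw [← hpow]; exact exp_mem_adjoin_exp_of_mem_span_int z hNw

/-- A DARK LINE (`w ∈ span_ℚ z` with `e^w` transcendental and algebraic over `ℚ(z)`) forces the entangled class. -/
theorem entangled_of_exp_isAlgebraic {n : ℕ} (z : Fin n → ℂ) {w : ℂ} (hw : w ∈ Submodule.span ℚ (Set.range z))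
    (halg : IsAlgebraic ↥(adjoin ℚ (Set.range z)) (cexp w)) (ht : Transcendental ℚ (cexp w)) :
    Algebra.trdeg ℚ ↥(adjoin ℚ (Set.range z ∪ Set.range (cexp ∘ z))) <
      Algebra.trdeg ℚ ↥(adjoin ℚ (Set.range z)) + Algebra.trdeg ℚ ↥(adjoin ℚ (Set.range (cexp ∘ z))) :=
  entangled_of_modularWitness z (modularWitness_of_exp_isAlgebraic z hw halg ht)

/-- DARK LINE proper: `w ∈ span_ℚ z` with `e^w` transcendental and algebraic over `ℚ(w)` alone. -/
theorem entangled_of_darkLine {n : ℕ} (z : Fin n → ℂ) {w : ℂ} (hw : w ∈ Submodule.span ℚ (Set.range z))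
    (halg : IsAlgebraic ↥(adjoin ℚ ({w} : Set ℂ)) (cexp w)) (ht : Transcendental ℚ (cexp w)) :
    Algebra.trdeg ℚ ↥(adjoin ℚ (Set.range z ∪ Set.range (cexp ∘ z))) <
      Algebra.trdeg ℚ ↥(adjoin ℚ (Set.range z)) + Algebra.trdeg ℚ ↥(adjoin ℚ (Set.range (cexp ∘ z))) := by
  refine entangled_of_exp_isAlgebraic z hw (isAlgebraic_of_le ?_ halg) ht
  exact adjoin_le_iff.mpr (Set.singleton_subset_iff.mpr (mem_adjoin_of_mem_span z hw))

/-- **LOG-DARK LINES ENTANGLE.**  If the ℚ-span of `z` contains a TRANSCENDENTAL `w` that is ALGEBRAIC OVER `ℚ(e^z)`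
(e.g. `w = e^{z_i} + e^{z_j}`, `w² = e^{z_i}`, a chain `z_j = e^{z_i}` read backwards), then `z` has a modular witness. -/
theorem modularWitness_of_isAlgebraic_exp_side {n : ℕ} (z : Fin n → ℂ) {w : ℂ} (hw : w ∈ Submodule.span ℚ (Set.range z))
    (ht : Transcendental ℚ w) (halg : IsAlgebraic ↥(adjoin ℚ (Set.range (cexp ∘ z))) w) : (∃ s : ℂ, Transcendental ℚ s ∧ IsAlgebraic ↥(adjoin ℚ (Set.range z)) s ∧ IsAlgebraic ↥(adjoin ℚ (Set.range (cexp ∘ z))) s) :=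
  ⟨w, ht, isAlgebraic_of_mem_adjoin (mem_adjoin_of_mem_span z hw), halg⟩

/-- A LOG-DARK LINE (`w ∈ span_ℚ z` transcendental and algebraic over `ℚ(e^z)`) forces the entangled class. -/
theorem entangled_of_isAlgebraic_exp_side {n : ℕ} (z : Fin n → ℂ) {w : ℂ} (hw : w ∈ Submodule.span ℚ (Set.range z))
    (ht : Transcendental ℚ w) (halg : IsAlgebraic ↥(adjoin ℚ (Set.range (cexp ∘ z))) w) :
    Algebra.trdeg ℚ ↥(adjoin ℚ (Set.range z ∪ Set.range (cexp ∘ z))) <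
      Algebra.trdeg ℚ ↥(adjoin ℚ (Set.range z)) + Algebra.trdeg ℚ ↥(adjoin ℚ (Set.range (cexp ∘ z))) :=
  entangled_of_modularWitness z (modularWitness_of_isAlgebraic_exp_side z hw ht halg)

/-- Recovery of round 10's placements as modular witnesses: a fixed point `e^ζ = ζ` in the span (`ζ ≠ 0` is automatic,
`ζ` transcendental by Hermite–Lindemann). -/
theorem modularWitness_of_fixedPoint_mem_span {n : ℕ} (z : Fin n → ℂ) {ζ : ℂ} (hζ : cexp ζ = ζ)
    (hmem : ζ ∈ Submodule.span ℚ (Set.range z)) : (∃ s : ℂ, Transcendental ℚ s ∧ IsAlgebraic ↥(adjoin ℚ (Set.range z)) s ∧ IsAlgebraic ↥(adjoin ℚ (Set.range (cexp ∘ z))) s) :=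
  modularWitness_of_exp_isAlgebraic z hmem
    (by rw [hζ]; exact isAlgebraic_of_mem_adjoin (mem_adjoin_of_mem_span z hmem))
    (by rw [hζ]; exact Summit.Schanuel.Schanuel.Theorems.RootDecomp1SharedDegree.transcendental_of_fixedPoint hζ)

/-- … and an exponential chain `e^{z_i} = z_j` with `z_j` transcendental. -/
theorem modularWitness_of_chain {n : ℕ} (z : Fin n → ℂ) (i j : Fin n) (h : cexp (z i) = z j)
    (ht : Transcendental ℚ (z j)) : (∃ s : ℂ, Transcendental ℚ s ∧ IsAlgebraic ↥(adjoin ℚ (Set.range z)) s ∧ IsAlgebraic ↥(adjoin ℚ (Set.range (cexp ∘ z))) s) :=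
  modularWitness_of_exp_isAlgebraic z (Submodule.subset_span ⟨i, rfl⟩)
    (by rw [h]; exact isAlgebraic_of_mem_adjoin (subset_adjoin ℚ _ ⟨j, rfl⟩)) (by rwa [h])

end Summit.Schanuel.Schanuel.Theorems.RootDecomp1ModularLayer

end
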